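import Summits.BirchSwinnertonDyer.BirchSwinnertonDyer.Theses.UniversalToricDescent
import Summits.BirchSwinnertonDyer.BirchSwinnertonDyer.Theorems.UniversalToricDescentTwinSplitIMCAtThreeOfThreeFrames
import Summits.BirchSwinnertonDyer.BirchSwinnertonDyer.Theorems.UniversalToricDescentSelfMuZeroAtThree
import Summits.BirchSwinnertonDyer.BirchSwinnertonDyer.Theorems.UniversalToricDescentBDPFlatMuTransfer
import Summits.BirchSwinnertonDyer.BirchSwinnertonDyer.Theorems.UniversalToricDescentToricTransportModThreeFlatGlue
import Summits.BirchSwinnertonDyer.BirchSwinnertonDyer.Theorems.UniversalToricDescentTwinAlgMuZeroAtThreeGoodOrd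
import Summits.BirchSwinnertonDyer.BirchSwinnertonDyer.Theorems.SchneiderFreeAdditiveX3BranchIMCHalves
import HarnessLib

/-!
# NODE `frame_anchor_squeeze` (crux-ideate STANDING COVER g13, unit `cruxidea-stmt-BirchSwinnertonDyer-24737-1-g13`,
# 2026-08-31) for the LIVE crux `UniversalToricDescent.TwinAlgMuZeroAtThree` (stmt-BirchSwinnertonDyer-24737, r205):
# «FRAME-ANCHORED LEADING-TERM SQUEEZE».

THE LEVER (new relative to the 21 lineage rows). The lineage reads the twin's algebraic `μ = 0` either off a
Λ-adic Kolyvagin-system UPPER bound `Ch ∣ 3^? · L` (rows K1‴/β-road, HOW-B, signed objects) or off ALL deep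
character layers at once (row 10, one-point squeeze / CH18 Thm 4.8). Here the Λ-adic strength is taken from the
OPPOSITE side — the route's OWN rational Wan/Eisenstein frame `∃ k, 3^k · Ch_Λ(X_{∅,0})·R₀⟦T⟧ ⊆ (L′)`
(E1 = the sibling crux `TwinSplitIMCAtThree…`'s registered stubs `stub_wanFrameSS_apZero` / `wanFrameMult_of_stubs`,
i.e. debts the route already carries) — and the Kolyvagin side is needed at ONE layer only, the leading Taylor
coefficient at `T = 0` (E3: `‖lead L′‖ ≤ ‖lead F‖`, `F` a generator of `Ch`). With Hsieh Thm B (E2, BY NAME = route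
item `TwinHsiehThmBInput`, 20711) the algebra is forced: `3 ∤ L′` ⇒ prime avoidance ⇒ `L′ ∣ F`, `F = L′·C`;
`lead F = lead L′ · lead C` (`PowerSeries.divXPowOrder_mul`) and the anchor give `‖lead C‖ = 1`, so `3 ∤ C`, so
`3 ∤ F` (`C(3)` is prime in `R₀⟦T⟧`): `F` has a coefficient of norm `1`. §1 proves this squeeze sorry-free.

In `K`-analytic rank 1, E3 is the classical Kolyvagin inequality `ord₃ #Ш(E′/K)[3^∞] ≤ 2·ord₃[E′(K):ℤy_K]`
(print at `ℓ = 3` for `ρ̄_{E′,3}` onto: Kolyvagin 1991 = Cha 2005 Thm 3 / Thm 21) sharpened by Jetchev's Tamagawa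
divisibility when ONE `q ∣ N′` has `3 ∣ c_q(E′)`, read through JSW 2017 Thm 3.3.1 (typed: `thm331_anticyclotomicControl_mult`
/ `_general`, `3 ≤ p`, both buckets) and the BDP value at `𝟙`; in `K`-rank ≥ 3 it is ONE inequality of the anticyclotomic
`p`-adic BSD conjecture for `L^BDP` (Castella–Hsu–Kundu–Lee–Liu 2025 Conj. 1.1(i); their Thm 1.5 computes `lead F`).
No stub restates the crux: E1 is an inclusion with unbounded `3`-power slack (no `μ`), E2 is print, E3 is implied by
the β-road's Λ-adic divisibility and is strictly weaker than it. BSD is not proved by any of this.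
-/

noncomputable section

open scoped Classical

set_option linter.dupNamespace false
set_option autoImplicit false

namespace Summit.BirchSwinnertonDyer.BirchSwinnertonDyer.Cruxes.TwinAlgMuZeroAtThree.FrameAnchorSqueeze

open PowerSeries WeierstrassCurve NumberField IsDedekindDomain Field
  Literature.NumberTheory.EllipticCurves
  Literature.NumberTheory.EllipticCurves.ModularForms
  Literature.NumberTheory.EllipticCurves.Rank1Residual
  Summit.BirchSwinnertonDyer.Rank1Residual.X11b
  Summit.BirchSwinnertonDyer.Rank1Residual.X11b.Halves
  Summit.BirchSwinnertonDyer.BirchSwinnertonDyer.Theorems.SchneiderFree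
  Summit.BirchSwinnertonDyer.BirchSwinnertonDyer.Theorems.UniversalToricDescentTwinSplit
  Summit.BirchSwinnertonDyer.BirchSwinnertonDyer.Theorems.UniversalToricDescentTwinAlgMu
  Summit.BirchSwinnertonDyer.BirchSwinnertonDyer.Theorems.UniversalToricDescentActDFlatGlue
  Summit.BirchSwinnertonDyer.BirchSwinnertonDyer.Theorems.BiquadraticEisensteinDescentEisensteinDivisibilityCMInertBadStubE3

/-! ## §1 The squeeze in `R₀⟦T⟧` (sorry-free) -/

section Algebra

variable {p : ℕ} [Fact p.Prime]

/-- The LEADING TAYLOR COEFFICIENT of `F ∈ R₀⟦T⟧` at `T = 0`: the coefficient of `T^{ord F}` (`0` iff `F = 0`). -/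
def lead (F : UnrSeries p) : unrIntegers p := PowerSeries.constantCoeff F.divXPowOrder

theorem lead_mul (A B : UnrSeries p) : lead (A * B) = lead A * lead B := by
  simp only [lead, PowerSeries.divXPowOrder_mul, map_mul]

theorem lead_ne_zero {F : UnrSeries p} (hF : F ≠ 0) : lead F ≠ 0 :=
  fun h ↦ hF (PowerSeries.constantCoeff_divXPowOrder_eq_zero_iff.mp h)

theorem lead_eq_coeff_order (F : UnrSeries p) : lead F = PowerSeries.coeff F.order.toNat F := by
  simp [lead, PowerSeries.constantCoeff_divXPowOrder]

theorem norm_lead_le_one (F : UnrSeries p) : ‖((lead F : unrIntegers p) : ℂ_[p])‖ ≤ 1 :=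
  norm_coe_unrIntegers_le_one p _

/-! **The anchor** of `F` to `L` is the pair of hypotheses `L ≠ 0` and `‖lead L‖ ≤ ‖lead F‖`: the leading Taylor
coefficient of `F` at `T = 0` is `p`-adically AT LEAST AS LARGE as that of `L` (`ord lead F ≤ ord lead L`). For `F` a
generator of `Ch_Λ(X_{∅,0})·R₀⟦T⟧` and `L` a BDP frame this is ONE layer (the trivial character, with multiplicity) of the
Kolyvagin-direction comparison; it is spelled out inline below (no `def : Prop`). -/

/-- `μ = 0` in coefficient currency ⟺ `C(p) ∤`. [folklore] -/
theorem not_C_dvd_iff_exists_norm_eq_one (F : UnrSeries p) :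
    ¬ (C ((p : ℕ) : unrIntegers p) : UnrSeries p) ∣ F ↔
      ∃ i : ℕ, ‖((PowerSeries.coeff i F : unrIntegers p) : ℂ_[p])‖ = 1 := by
  constructor
  · intro h
    by_contra hne
    push Not at hne
    exact h (C_dvd_of_forall_norm_coeff_lt_one fun j ↦
      lt_of_le_of_ne (norm_coe_unrIntegers_le_one p _) (hne j))
  · rintro ⟨i, hi⟩
    exact not_C_dvd_of_isUnit_coeff ⟨i, (unrIntegers.isUnit_iff_norm_eq_one _).mpr hi⟩

/-- Gauss: `μ(A) = μ(B) = 0 ⇒ μ(A·B) = 0` (`C(p)` is prime in `R₀⟦T⟧`). [folklore] -/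
theorem exists_norm_coeff_eq_one_mul {A B : UnrSeries p}
    (hA : ∃ i : ℕ, ‖((PowerSeries.coeff i A : unrIntegers p) : ℂ_[p])‖ = 1)
    (hB : ∃ i : ℕ, ‖((PowerSeries.coeff i B : unrIntegers p) : ℂ_[p])‖ = 1) :
    ∃ i : ℕ, ‖((PowerSeries.coeff i (A * B) : unrIntegers p) : ℂ_[p])‖ = 1 := by
  rw [← not_C_dvd_iff_exists_norm_eq_one] at hA hB ⊢
  exact fun h ↦ (prime_C_natCast_p.dvd_or_dvd h).elim hA hB

theorem exists_norm_coeff_eq_one_of_norm_lead {F : UnrSeries p} (h : ‖((lead F : unrIntegers p) : ℂ_[p])‖ = 1) :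
    ∃ i : ℕ, ‖((PowerSeries.coeff i F : unrIntegers p) : ℂ_[p])‖ = 1 :=
  ⟨F.order.toNat, by rwa [lead_eq_coeff_order] at h⟩

/-- **THE SQUEEZE.** If `L ∣ F` (Wan side, after prime avoidance), `L` has a coefficient of norm `1` (Hsieh side)
and the leading coefficient of `F` at `T = 0` is at least that of `L` in norm (one anchored layer), then `F` has a
coefficient of norm `1`: writing `F = L·C`, `lead F = lead L · lead C` forces `‖lead C‖ = 1`, so `3 ∤ C`, so `3 ∤ F`. -/
theorem exists_norm_coeff_eq_one_of_dvd_of_leadAnchor {F L : UnrSeries p} (hdvd : L ∣ F)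
    (hμ : ∃ i : ℕ, ‖((PowerSeries.coeff i L : unrIntegers p) : ℂ_[p])‖ = 1) (hL0 : L ≠ 0)
    (hle : ‖((lead L : unrIntegers p) : ℂ_[p])‖ ≤ ‖((lead F : unrIntegers p) : ℂ_[p])‖) :
    ∃ i : ℕ, ‖((PowerSeries.coeff i F : unrIntegers p) : ℂ_[p])‖ = 1 := by
  obtain ⟨Q, rfl⟩ := hdvd
  have hL0' : ((lead L : unrIntegers p) : ℂ_[p]) ≠ 0 := by
    intro h
    exact lead_ne_zero hL0 (by exact_mod_cast h)
  have hpos : 0 < ‖((lead L : unrIntegers p) : ℂ_[p])‖ := norm_pos_iff.mpr hL0'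
  rw [lead_mul] at hle
  push_cast at hle
  rw [norm_mul] at hle
  have hQ1 : 1 ≤ ‖((lead Q : unrIntegers p) : ℂ_[p])‖ := by
    by_contra hlt
    push Not at hlt
    have := mul_lt_of_lt_one_right hpos hlt
    linarith
  exact exists_norm_coeff_eq_one_mul hμ
    (exists_norm_coeff_eq_one_of_norm_lead (le_antisymm (norm_lead_le_one Q) hQ1))

/-- The anchor is FRAME-INDEPENDENT: it transports along a unit `u` of `R₀⟦T⟧` (two BDP frames of the same datum
differ by one, `span_singleton_eq_of_isBDPLFunction`), since `‖lead u‖ = 1`. -/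
theorem leadAnchor_of_isUnit_mul {F L : UnrSeries p} {u : UnrSeries p} (hu : IsUnit u) (hL0 : L ≠ 0)
    (hle : ‖((lead L : unrIntegers p) : ℂ_[p])‖ ≤ ‖((lead F : unrIntegers p) : ℂ_[p])‖) :
    u * L ≠ 0 ∧ ‖((lead (u * L) : unrIntegers p) : ℂ_[p])‖ ≤ ‖((lead F : unrIntegers p) : ℂ_[p])‖ := by
  have hlu : IsUnit (lead u) := by
    obtain ⟨v, hv⟩ := hu.exists_right_inv
    refine IsUnit.of_mul_eq_one (lead v) ?_
    rw [← lead_mul, hv]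
    simp [lead, PowerSeries.divXPowOrder_one]
  have hu0 : ‖((lead u : unrIntegers p) : ℂ_[p])‖ = 1 := (unrIntegers.isUnit_iff_norm_eq_one _).mp hlu
  refine ⟨(hu.mul_right_eq_zero).not.mpr hL0, ?_⟩
  rw [lead_mul]
  push_cast
  rw [norm_mul, hu0, one_mul]
  exact hle

end Algebra

/-! ## §2 The three pieces (registered stubs) -/

/-- STUB E1 — THE ROUTE'S OWN RATIONAL WAN / EISENSTEIN FRAME at the twin, on 24737's bucket guard (B: multiplicative
très ramifié at 3; C₀: good supersingular `a₃ = 0`): ONE BDP frame `L′` with `∃ k, 3^k · Ch_Λ(X_{∅,0})·R₀⟦T⟧ ⊆ (L′)`.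
TEXT = the sibling crux skeletons' registered stubs, by name: `Cruxes/TwinSplitIMCAtThreeGoodSSApZero/Lines/threeframes_apzero.lean ::
stub_wanFrameSS_apZero` (C₀; NOT in print at p = 3 — research) and `Cruxes/TwinSplitIMCAtThreeMult/Lines/threeframes.lean ::
wanFrameMult_of_stubs` (B; DERIVED there from the rational member tower = route items 22539/27401's children + the landed
descent kernel p616714, the cube locus being disjoint from «3 ∤ v₃(Δ′)»). UNDECIDED relative to the crux (an inclusion with
unbounded 3-power slack carries no `μ`); NO NEW DEBT: it is on the books for `TwinSplitIMCAtThree` (closes-chain binder h3).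
[cite: Wan2020RankinSelbergIMC, Thm. 1.1 (Algebra Number Theory 14 (2020) 383–483; the U(3,1) lower bound, p ordinary)]
[cite: Castella2018Erratum, proof of Thm. 1.1 (p. 4) (shape of the frame clause)] -/
theorem stub_frameInclusion :
    ∀ (W' : WeierstrassCurve ℚ) [W'.IsElliptic] [W'.IsGloballyMinimal] (N' : ℕ) [NeZero N']
      (K : Type) [Field K] [NumberField K] (Dt' : ModularParametrizationData W' N'),
      (Mult W' 3 ∧ ¬ 3 ∣ padicValInt 3 W'.minimalDiscriminantInt ∨ GoodSS W' 3 ∧ W'.frobeniusTrace 3 = 0) →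
      W'.HasSurjectiveModNGaloisRep 3 → W'.conductorNorm ℤ = N' → IsImaginaryQuadratic K →
      SatisfiesHeegnerHypothesis N' K → Odd (NumberField.discr K) →
      ∀ (κ : ZpExtension K 3), κ.IsAnticyclotomic → ∀ (γ : absoluteGaloisGroup K) [Fact (κ.IsTopGenerator γ)]
        (𝔭 : HeightOneSpectrum (𝓞 K)), ((3 : ℕ) : 𝓞 K) ∈ 𝔭.asIdeal →
        𝔭.asIdeal.ramificationIdx (𝓞 ℚ) = 1 → 𝔭.asIdeal.inertiaDeg (𝓞 ℚ) = 1 →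
        ∀ (𝔭' : HeightOneSpectrum (𝓞 K)), ((3 : ℕ) : 𝓞 K) ∈ 𝔭'.asIdeal → 𝔭' ≠ 𝔭 →
        ∀ (ι' : PadicAlgCl 3 ≃+* ℂ), BranchInducesPrime 3 ι' 𝔭 →
        ∃ (ΩK : ℂ) (Ωp : ℂ_[3]) (L : UnrSeries 3), ΩK ≠ 0 ∧ Ωp ≠ 0 ∧
          IsBDPLFunction ι' 𝔭 κ γ Dt'.f ΩK Ωp L ∧
          ∃ k : ℕ, ∀ G ∈ (AcSelmer.XAc.charIdeal (W'.baseChange K) 3 κ 𝔭' ∅ γ).map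
            (PowerSeries.map (toUnr 3)), PowerSeries.C (((3 : ℕ) : unrIntegers 3) ^ k) * G ∈ Ideal.span {L} := by
  sorry

/-- STUB E2 — Hsieh 2014 Thm. B at every level, BY NAME = route item `TwinHsiehThmBInput` (stmt-20711; print, closes only
by formalisation). WEAKER than the crux (a published fact). [cite: Hsieh2014, Thm. B p. 712 (Doc. Math. 19)] -/
theorem stub_thmB : Summit.BirchSwinnertonDyer.BirchSwinnertonDyer.Theses.UniversalToricDescent.TwinHsiehThmBInput := by
  sorry

/-- STUB E3 — ONE ANCHORED LAYER (the Kolyvagin direction at the trivial character, with multiplicity): `X_{∅,0}(E′/K_∞)`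
strict at `𝔭′` is Λ-torsion, and for a generator `f` of `Ch_Λ` and ANY BDP frame `L′` of `f_{E′}` at any `ι′` inducing `𝔭`,
`‖lead L′‖ ≤ ‖lead f‖` (leading Taylor coefficients at `T = 0`). In K-analytic rank 1 this is Kolyvagin's
`ord₃ #Ш(E′/K) ≤ 2 ord₃[E′(K):ℤy_K]` (print at ℓ = 3 for ρ̄ onto) + Jetchev's Tamagawa sharpening (≤ 1 prime q ∣ N′ with
3 ∣ c_q) through JSW Thm 3.3.1 (typed, 3 ≤ p, both buckets) and the BDP value at 𝟙; in rank ≥ 3 it is the inequality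
`ord lead L^BDP ≥ ord lead F` of CHKLL Conj. 1.1(i) (Thm 1.5 computes the right side; research). Implied by the β-road's
Λ-adic divisibility (K1‴ + K2a‴) and strictly weaker than it. UNDECIDED; ATTACKABLE on the rank-1 / ≤ 1-Tamagawa-3 sub-bucket.
[cite: Cha2005, Thm. 3 (Kolyvagin) and Thm. 21 (J. Number Theory 111, pp. 155, 173)]
[cite: JetchevSkinnerWan2017, Thm. 3.3.1 (arXiv:1512.06894 Thm. 8)] [cite: CastellaEtAl2023, Conj. 1.1 (i) and Thm. 1.5 (arXiv:2308.10474 pp. 3–4)] [cite: Jetchev2008, Thm. 1.1 (Compositio Math. 144, 811–826)] -/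
theorem stub_leadAnchor :
    ∀ (W' : WeierstrassCurve ℚ) [W'.IsElliptic] [W'.IsGloballyMinimal] (N' : ℕ) [NeZero N']
      (K : Type) [Field K] [NumberField K] (Dt' : ModularParametrizationData W' N'),
      (Mult W' 3 ∧ ¬ 3 ∣ padicValInt 3 W'.minimalDiscriminantInt ∨ GoodSS W' 3 ∧ W'.frobeniusTrace 3 = 0) →
      W'.HasSurjectiveModNGaloisRep 3 → W'.conductorNorm ℤ = N' → IsImaginaryQuadratic K →
      SatisfiesHeegnerHypothesis N' K → Odd (NumberField.discr K) →
      ∀ (κ : ZpExtension K 3), κ.IsAnticyclotomic → ∀ (γ : absoluteGaloisGroup K) [Fact (κ.IsTopGenerator γ)]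
        (𝔭 : HeightOneSpectrum (𝓞 K)), ((3 : ℕ) : 𝓞 K) ∈ 𝔭.asIdeal →
        𝔭.asIdeal.ramificationIdx (𝓞 ℚ) = 1 → 𝔭.asIdeal.inertiaDeg (𝓞 ℚ) = 1 →
        ∀ (𝔭' : HeightOneSpectrum (𝓞 K)), ((3 : ℕ) : 𝓞 K) ∈ 𝔭'.asIdeal → 𝔭' ≠ 𝔭 →
        ∀ (ι' : PadicAlgCl 3 ≃+* ℂ), BranchInducesPrime 3 ι' 𝔭 →
        ∀ (ΩK : ℂ) (Ωp : ℂ_[3]) (L : UnrSeries 3), ΩK ≠ 0 → Ωp ≠ 0 →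
          IsBDPLFunction ι' 𝔭 κ γ Dt'.f ΩK Ωp L →
          Module.IsTorsion (IwasawaAlgebra 3) (AcSelmer.XAc (W'.baseChange K) 3 κ 𝔭' ∅ γ) ∧
          ∃ f : IwasawaAlgebra 3, AcSelmer.XAc.charIdeal (W'.baseChange K) 3 κ 𝔭' ∅ γ = Ideal.span {f} ∧
            L ≠ 0 ∧ ‖((lead L : unrIntegers 3) : ℂ_[3])‖ ≤ ‖((lead (PowerSeries.map (toUnr 3) f) : unrIntegers 3) : ℂ_[3])‖ := by
  sorry

/-! ## §3 Composition: the crux BY NAME -/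

/-- DERIVED (no sorry of its own): every BDP frame of the twin has a coefficient of norm `1`, from E2 (Hsieh Thm B moved
across periods: `self_exists_isBDPLFunctionInt_coeff_norm_eq_one` + `exists_coeff_norm_eq_one_of_isBDPLFunctionInt_of_isBDPLFunction`).
[cite: Hsieh2014, Thm. B p. 712 (Doc. Math. 19)] [cite: Castella2018, Thm. 3.1 (arXiv:1704.06608 p. 9)] -/
theorem exists_norm_coeff_eq_one_of_frame
    (hB : Summit.BirchSwinnertonDyer.BirchSwinnertonDyer.Theses.UniversalToricDescent.TwinHsiehThmBInput)
    (W : WeierstrassCurve ℚ) [W.IsElliptic] (N : ℕ) [NeZero N]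
    (K : Type) [Field K] [NumberField K] (Dt : ModularParametrizationData W N)
    (honto : W.HasSurjectiveModNGaloisRep 3) (hK : IsImaginaryQuadratic K)
    (hH : SatisfiesHeegnerHypothesis N K) (κ : ZpExtension K 3) (hκ : κ.IsAnticyclotomic)
    (γ : absoluteGaloisGroup K) [Fact (κ.IsTopGenerator γ)]
    (𝔭 : HeightOneSpectrum (𝓞 K)) (h𝔭 : ((3 : ℕ) : 𝓞 K) ∈ 𝔭.asIdeal)
    (he : 𝔭.asIdeal.ramificationIdx (𝓞 ℚ) = 1) (hf : 𝔭.asIdeal.inertiaDeg (𝓞 ℚ) = 1)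
    (ι' : PadicAlgCl 3 ≃+* ℂ) (hι' : BranchInducesPrime 3 ι' 𝔭)
    {ΩK : ℂ} {Ωp : ℂ_[3]} {L : UnrSeries 3} (hΩK : ΩK ≠ 0) (hΩp : Ωp ≠ 0)
    (hL : IsBDPLFunction ι' 𝔭 κ γ Dt.f ΩK Ωp L) :
    ∃ i : ℕ, ‖((PowerSeries.coeff i L : unrIntegers 3) : ℂ_[3])‖ = 1 := by
  obtain ⟨ΩK₁, Ωp₁, Q, hΩK₁, hΩp₁, hQ, hμQ⟩ :=
    Summit.BirchSwinnertonDyer.BirchSwinnertonDyer.Theorems.UniversalToricDescentSelfMuZero.self_exists_isBDPLFunctionInt_coeff_norm_eq_one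
      hB W N K Dt honto hK hH κ hκ γ 𝔭 h𝔭 he hf ι' hι'
  have hΩp₁0 : Ωp₁ ≠ 0 := fun h ↦ by rw [h, norm_zero] at hΩp₁; exact zero_ne_one hΩp₁
  exact Summit.BirchSwinnertonDyer.BirchSwinnertonDyer.Theorems.UniversalToricDescentFlatMuTransfer.exists_coeff_norm_eq_one_of_isBDPLFunctionInt_of_isBDPLFunction
    hK hκ Fact.out hΩK₁ hΩK hΩp₁0 hΩp hQ hL hμQ

/-- **COMPOSITION — the crux `TwinAlgMuZeroAtThree` BY NAME from E1 + E2 + E3.** Pick `ι′` inducing `𝔭`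
(`exists_branchInducesPrime`); E1 gives a frame `L′` and `k` with `3^k·Ch ⊆ (L′)`; E2 gives `L′` a norm-one coefficient, so
`3 ∤ L′` and prime avoidance (`mem_span_of_C_pow_mul_mem_span`) puts the image `F` of E3's generator `f` in `(L′)`; E3 gives
torsion and the anchor; §1's squeeze gives `F` a norm-one coefficient; `Ch·R₀⟦T⟧ = (F)` (`map_span_singleton_eq`). -/
theorem TwinAlgMuZeroAtThree_of_pieces
    (h₁ : ∀ (W' : WeierstrassCurve ℚ) [W'.IsElliptic] [W'.IsGloballyMinimal] (N' : ℕ) [NeZero N']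
      (K : Type) [Field K] [NumberField K] (Dt' : ModularParametrizationData W' N'),
      (Mult W' 3 ∧ ¬ 3 ∣ padicValInt 3 W'.minimalDiscriminantInt ∨ GoodSS W' 3 ∧ W'.frobeniusTrace 3 = 0) →
      W'.HasSurjectiveModNGaloisRep 3 → W'.conductorNorm ℤ = N' → IsImaginaryQuadratic K →
      SatisfiesHeegnerHypothesis N' K → Odd (NumberField.discr K) →
      ∀ (κ : ZpExtension K 3), κ.IsAnticyclotomic → ∀ (γ : absoluteGaloisGroup K) [Fact (κ.IsTopGenerator γ)]
        (𝔭 : HeightOneSpectrum (𝓞 K)), ((3 : ℕ) : 𝓞 K) ∈ 𝔭.asIdeal →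
        𝔭.asIdeal.ramificationIdx (𝓞 ℚ) = 1 → 𝔭.asIdeal.inertiaDeg (𝓞 ℚ) = 1 →
        ∀ (𝔭' : HeightOneSpectrum (𝓞 K)), ((3 : ℕ) : 𝓞 K) ∈ 𝔭'.asIdeal → 𝔭' ≠ 𝔭 →
        ∀ (ι' : PadicAlgCl 3 ≃+* ℂ), BranchInducesPrime 3 ι' 𝔭 →
        ∃ (ΩK : ℂ) (Ωp : ℂ_[3]) (L : UnrSeries 3), ΩK ≠ 0 ∧ Ωp ≠ 0 ∧
          IsBDPLFunction ι' 𝔭 κ γ Dt'.f ΩK Ωp L ∧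
          ∃ k : ℕ, ∀ G ∈ (AcSelmer.XAc.charIdeal (W'.baseChange K) 3 κ 𝔭' ∅ γ).map
            (PowerSeries.map (toUnr 3)), PowerSeries.C (((3 : ℕ) : unrIntegers 3) ^ k) * G ∈ Ideal.span {L})
    (h₂ : Summit.BirchSwinnertonDyer.BirchSwinnertonDyer.Theses.UniversalToricDescent.TwinHsiehThmBInput)
    (h₃ : ∀ (W' : WeierstrassCurve ℚ) [W'.IsElliptic] [W'.IsGloballyMinimal] (N' : ℕ) [NeZero N']
      (K : Type) [Field K] [NumberField K] (Dt' : ModularParametrizationData W' N'),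
      (Mult W' 3 ∧ ¬ 3 ∣ padicValInt 3 W'.minimalDiscriminantInt ∨ GoodSS W' 3 ∧ W'.frobeniusTrace 3 = 0) →
      W'.HasSurjectiveModNGaloisRep 3 → W'.conductorNorm ℤ = N' → IsImaginaryQuadratic K →
      SatisfiesHeegnerHypothesis N' K → Odd (NumberField.discr K) →
      ∀ (κ : ZpExtension K 3), κ.IsAnticyclotomic → ∀ (γ : absoluteGaloisGroup K) [Fact (κ.IsTopGenerator γ)]
        (𝔭 : HeightOneSpectrum (𝓞 K)), ((3 : ℕ) : 𝓞 K) ∈ 𝔭.asIdeal →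
        𝔭.asIdeal.ramificationIdx (𝓞 ℚ) = 1 → 𝔭.asIdeal.inertiaDeg (𝓞 ℚ) = 1 →
        ∀ (𝔭' : HeightOneSpectrum (𝓞 K)), ((3 : ℕ) : 𝓞 K) ∈ 𝔭'.asIdeal → 𝔭' ≠ 𝔭 →
        ∀ (ι' : PadicAlgCl 3 ≃+* ℂ), BranchInducesPrime 3 ι' 𝔭 →
        ∀ (ΩK : ℂ) (Ωp : ℂ_[3]) (L : UnrSeries 3), ΩK ≠ 0 → Ωp ≠ 0 →
          IsBDPLFunction ι' 𝔭 κ γ Dt'.f ΩK Ωp L →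
          Module.IsTorsion (IwasawaAlgebra 3) (AcSelmer.XAc (W'.baseChange K) 3 κ 𝔭' ∅ γ) ∧
          ∃ f : IwasawaAlgebra 3, AcSelmer.XAc.charIdeal (W'.baseChange K) 3 κ 𝔭' ∅ γ = Ideal.span {f} ∧
            L ≠ 0 ∧ ‖((lead L : unrIntegers 3) : ℂ_[3])‖ ≤ ‖((lead (PowerSeries.map (toUnr 3) f) : unrIntegers 3) : ℂ_[3])‖) :
    Summit.BirchSwinnertonDyer.BirchSwinnertonDyer.Theses.UniversalToricDescent.TwinAlgMuZeroAtThree := by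
  intro W' _ _ N' _ K _ _ Dt' hbk hsurj hN' hK hH hodd κ hκ γ _ 𝔭 h𝔭 he hf 𝔭' h𝔭' hne
  -- a branch `ι′` inducing `𝔭` (never an empty quantifier)
  obtain ⟨ι', hι'⟩ := exists_branchInducesPrime 3 hK h𝔭
  -- E1: the Wan frame
  obtain ⟨ΩK, Ωp, L, hΩK, hΩp, hL, k, hincl⟩ :=
    h₁ W' N' K Dt' hbk hsurj hN' hK hH hodd κ hκ γ 𝔭 h𝔭 he hf 𝔭' h𝔭' hne ι' hι'
  -- E2: `μ(L′) = 0`, hence `3 ∤ L′`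
  have hμ : ∃ i : ℕ, ‖((PowerSeries.coeff i L : unrIntegers 3) : ℂ_[3])‖ = 1 :=
    exists_norm_coeff_eq_one_of_frame h₂ W' N' K Dt' hsurj hK hH κ hκ γ 𝔭 h𝔭 he hf ι' hι' hΩK hΩp hL
  have h3L : ¬ (C (((3 : ℕ) : unrIntegers 3)) : UnrSeries 3) ∣ L :=
    (not_C_dvd_iff_exists_norm_eq_one L).mpr hμ
  -- E3: torsion, a generator, the anchor at this frame
  obtain ⟨htors, f, hchar, hL0, hle⟩ :=
    h₃ W' N' K Dt' hbk hsurj hN' hK hH hodd κ hκ γ 𝔭 h𝔭 he hf 𝔭' h𝔭' hne ι' hι' ΩK Ωp L hΩK hΩp hL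
  set F : UnrSeries 3 := PowerSeries.map (toUnr 3) f with hF
  -- `F ∈ Ch·R₀⟦T⟧`, so `3^k · F ∈ (L′)`, so `F ∈ (L′)` by prime avoidance
  have hFmem : F ∈ (AcSelmer.XAc.charIdeal (W'.baseChange K) 3 κ 𝔭' ∅ γ).map (PowerSeries.map (toUnr 3)) := by
    rw [hchar]
    exact Ideal.mem_map_of_mem _ (Ideal.mem_span_singleton_self f)
  have hkF : (C (((3 : ℕ) : unrIntegers 3)) : UnrSeries 3) ^ k * F ∈ Ideal.span {L} := by
    have := hincl F hFmem
    rwa [map_pow] at this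
  have hdvd : L ∣ F := Ideal.mem_span_singleton.mp (mem_span_of_C_pow_mul_mem_span h3L hkF)
  -- the squeeze
  have hunit : ∃ i : ℕ, ‖((PowerSeries.coeff i F : unrIntegers 3) : ℂ_[3])‖ = 1 :=
    exists_norm_coeff_eq_one_of_dvd_of_leadAnchor hdvd hμ hL0 hle
  refine ⟨htors, F, ?_, hunit⟩
  rw [hchar, map_span_singleton_eq]

/-- **The crux BY NAME from the three registered stubs.** -/
theorem TwinAlgMuZeroAtThree_of :
    Summit.BirchSwinnertonDyer.BirchSwinnertonDyer.Theses.UniversalToricDescent.TwinAlgMuZeroAtThree :=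
  TwinAlgMuZeroAtThree_of_pieces stub_frameInclusion stub_thmB stub_leadAnchor

end Summit.BirchSwinnertonDyer.BirchSwinnertonDyer.Cruxes.TwinAlgMuZeroAtThree.FrameAnchorSqueeze

end
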